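import Mathlib
import Summits.AtomisticToContinuum.HydrodynamicLimit.Theorems.OneSphereInfluenceStaticScoreResponseCumulantBounds
import Literature.Analysis.Complex.CauchyTaylorBall
import HarnessLib

/-!
# `StaticScoreResponse` (support item stmt-AtomisticToContinuum-12269): uniform-in-`n` variance,
# covariance and Taylor bounds for the canonical hard-sphere gas at small packing

Cauchy's estimates (`Literature.Analysis.Complex.CauchyTaylorBall`) for the holomorphic extension
`Φ` (`‖Φ‖ ≤ 3` on `‖s‖ < 1/4`) of the tilted canonical log-partition function, whose real derivatives
are the tilted canonical means and variances of `S_G = ∑ᵢ G(xᵢ)`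
(`exists_analytic_logPartition_deriv`), give — for a continuous positive activity `b`, continuous
observables bounded by `1`, `0 ≤ ε < 1/2`, `n ≥ 1` and the smallness `2A²e⁴ n p_ε ≤ 1`, UNIFORMLY IN `n`:

* `variance_bound` — `n⁻¹ Var_b(S_G) ≤ 1536` (`= 8 · 3 / (1/8)²`);
* `tilted_mean_taylor_bound` — `|E_s[n⁻¹S_G] - E_0[n⁻¹S_G] - s · n⁻¹Var_0(S_G)| ≤ 24576 s²` for
  `|s| ≤ 1/32` (order-two Taylor remainder of `Φ'`, `‖Φ'‖ ≤ 48` on `‖s‖ < 1/8`);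
* `covariance_bound` — `|n⁻¹ Cov_b(S_H, S_G)| ≤ 3072` (polarisation
  `Cov(S_H, S_G) = Var(S_U) - Var(S_W)`, `U = (H+G)/2`, `W = (H-G)/2`).

Here `E_s`, `Var`, `Cov` are expectations under `posGibbsMeasure (b e^{sG}) ε n` written out as
integrals. These are the inputs `K s²` and the equicontinuity constants for the real-analysis lemmas
of `OneSphereInfluenceStaticScoreResponseRealAnalysis`. Folklore; no definitions, no named facts.
-/

noncomputable section

namespace Summit.AtomisticToContinuum.HydrodynamicLimit.Theorems

open Finset MeasureTheory Complex Metric Set Filter Topology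
  Literature.MathematicalPhysics.StatisticalMechanics Literature.MathematicalPhysics.KineticTheory
  Literature.Analysis.Complex

variable {b G H : T3 → ℝ}

/-! ### Cauchy bounds for the extension -/

/-- A disc of radius `1/8` around a real point `|s| < 1/8` lies in the disc `‖z‖ < 1/4`. [folklore] -/
theorem ball_ofReal_subset {s : ℝ} (hs : |s| < 1 / 8) : ball ((s : ℝ) : ℂ) (1 / 8) ⊆ ball (0 : ℂ) (1 / 4) := by
  intro z hz
  rw [mem_ball, dist_eq_norm] at hz ⊢
  rw [sub_zero]
  have h1 : ‖z‖ ≤ ‖z - (s : ℂ)‖ + ‖(s : ℂ)‖ := norm_le_norm_sub_add z s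
  rw [Complex.norm_real, Real.norm_eq_abs] at h1
  linarith

/-- **Cauchy bound on `Φ''`**: `‖Φ''(s)‖ ≤ 1536` at real `|s| < 1/8` for `Φ` holomorphic and bounded
by `3` on `‖z‖ < 1/4`. [folklore] -/
theorem norm_deriv_deriv_le {Φ : ℂ → ℂ} (hΦ : DifferentiableOn ℂ Φ (ball 0 (1 / 4)))
    (hΦ3 : ∀ z ∈ ball (0 : ℂ) (1 / 4), ‖Φ z‖ ≤ 3) {s : ℝ} (hs : |s| < 1 / 8) :
    ‖deriv (deriv Φ) s‖ ≤ 1536 := by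
  have hsub := ball_ofReal_subset hs
  have h := norm_iteratedDeriv_two_le_of_forall_mem_ball (c := ((s : ℝ) : ℂ)) (R := 1 / 8) (M := 3)
    (by norm_num) (hΦ.mono hsub) fun z hz => hΦ3 z (hsub hz)
  rw [iteratedDeriv_succ, iteratedDeriv_one] at h
  refine h.trans ?_
  norm_num

/-- **Cauchy bound on `Φ'`**: `‖Φ'(z)‖ ≤ 48` on `‖z‖ < 1/8`. [folklore] -/
theorem norm_deriv_le_of_mem_ball {Φ : ℂ → ℂ} (hΦ : DifferentiableOn ℂ Φ (ball 0 (1 / 4)))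
    (hΦ3 : ∀ z ∈ ball (0 : ℂ) (1 / 4), ‖Φ z‖ ≤ 3) {z : ℂ} (hz : z ∈ ball (0 : ℂ) (1 / 8)) :
    ‖deriv Φ z‖ ≤ 48 := by
  have hsub : ball z (1 / 8) ⊆ ball (0 : ℂ) (1 / 4) := by
    intro w hw
    rw [mem_ball, dist_eq_norm] at hw hz ⊢
    rw [sub_zero] at hz ⊢
    have h1 : ‖w‖ ≤ ‖w - z‖ + ‖z‖ := norm_le_norm_sub_add w z
    linarith
  have h := norm_deriv_le_of_forall_mem_ball (c := z) (R := 1 / 8) (M := 3) (by norm_num) (hΦ.mono hsub)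
    fun w hw => hΦ3 w (hsub hw)
  refine h.trans ?_
  norm_num

/-- **Taylor bound for `Φ'`**: `‖Φ'(s) - Φ'(0) - s Φ''(0)‖ ≤ 24576 s²` for real `|s| ≤ 1/32`.
[folklore] -/
theorem norm_deriv_taylor_le {Φ : ℂ → ℂ} (hΦ : DifferentiableOn ℂ Φ (ball 0 (1 / 4)))
    (hΦ3 : ∀ z ∈ ball (0 : ℂ) (1 / 4), ‖Φ z‖ ≤ 3) {s : ℝ} (hs : |s| ≤ 1 / 32) :
    ‖deriv Φ s - deriv Φ 0 - (s : ℂ) * deriv (deriv Φ) 0‖ ≤ 24576 * s ^ 2 := by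
  have hΦ'd : DifferentiableOn ℂ (deriv Φ) (ball 0 (1 / 8)) :=
    ((hΦ.analyticOnNhd isOpen_ball).deriv.differentiableOn).mono (ball_subset_ball (by norm_num))
  have h := norm_sub_sub_le_of_forall_mem_ball (f := deriv Φ) (c := 0) (R := 1 / 8) (M := 48) (by norm_num)
    hΦ'd (fun z hz => norm_deriv_le_of_mem_ball hΦ hΦ3 hz) (z := ((s : ℝ) : ℂ))
    (by rw [sub_zero, Complex.norm_real, Real.norm_eq_abs]; linarith)
  rw [sub_zero, smul_eq_mul, Complex.norm_real, Real.norm_eq_abs, sq_abs] at h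
  refine h.trans (le_of_eq ?_)
  ring

/-! ### The bounds for the canonical gas -/

/-- **Uniform variance bound.** `n⁻¹ Var_s(S_G) ≤ 1536` for the tilted canonical Gibbs measures,
real `|s| < 1/8`, continuous `|G| ≤ 1`, under the smallness condition (uniformly in `n`). The variance
is written as `E[n⁻¹S_G · S_G] - E[n⁻¹S_G] E[S_G]`. [folklore] -/
theorem tilted_variance_bound (hb : Continuous b) (hb0 : ∀ x, 0 < b x) (hGc : Continuous G)
    (hG1 : ∀ x, |G x| ≤ 1) {ε : ℝ} (hε : 0 ≤ ε) (hε2 : ε < 1 / 2) {n : ℕ} (hn : 0 < n)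
    (hsmall : 2 * (2 * Real.exp (1 / 4)) ^ 2 * Real.exp 1 ^ 4 * (n * pOv (profileOf b hb hb0) ε) ≤ 1)
    {s : ℝ} (hs : |s| < 1 / 8) :
    |(∫ x, ((n : ℝ)⁻¹ * ∑ i, G (x i)) * ∑ i, G (x i) ∂posGibbsMeasure (fun x => b x * Real.exp (s * G x)) ε n) -
        (∫ x, (n : ℝ)⁻¹ * ∑ i, G (x i) ∂posGibbsMeasure (fun x => b x * Real.exp (s * G x)) ε n) *
          ∫ x, ∑ i, G (x i) ∂posGibbsMeasure (fun x => b x * Real.exp (s * G x)) ε n| ≤ 1536 := by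
  obtain ⟨Φ, hΦ, hΦ3, hreal⟩ := exists_analytic_logPartition_deriv hb hb0 hGc hG1 hε hε2 hn hsmall
  obtain ⟨-, -, h2⟩ := hreal s (hs.trans (by norm_num))
  rw [← h2]
  exact (Complex.abs_re_le_norm _).trans (norm_deriv_deriv_le hΦ hΦ3 hs)

/-- **Uniform variance bound at the base activity**: `n⁻¹ Var_b(S_G) ≤ 1536`. [folklore] -/
theorem variance_bound (hb : Continuous b) (hb0 : ∀ x, 0 < b x) (hGc : Continuous G)
    (hG1 : ∀ x, |G x| ≤ 1) {ε : ℝ} (hε : 0 ≤ ε) (hε2 : ε < 1 / 2) {n : ℕ} (hn : 0 < n)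
    (hsmall : 2 * (2 * Real.exp (1 / 4)) ^ 2 * Real.exp 1 ^ 4 * (n * pOv (profileOf b hb hb0) ε) ≤ 1) :
    |(n : ℝ)⁻¹ * ((∫ x, (∑ i, G (x i)) * ∑ i, G (x i) ∂posGibbsMeasure b ε n) -
        (∫ x, ∑ i, G (x i) ∂posGibbsMeasure b ε n) * ∫ x, ∑ i, G (x i) ∂posGibbsMeasure b ε n)| ≤ 1536 := by
  have h := tilted_variance_bound hb hb0 hGc hG1 hε hε2 hn hsmall (s := 0) (by norm_num)
  rw [tilt_zero] at h
  have e1 : (∫ x, ((n : ℝ)⁻¹ * ∑ i, G (x i)) * ∑ i, G (x i) ∂posGibbsMeasure b ε n) =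
      (n : ℝ)⁻¹ * ∫ x, (∑ i, G (x i)) * ∑ i, G (x i) ∂posGibbsMeasure b ε n := by
    rw [← integral_const_mul]
    exact integral_congr_ae (ae_of_all _ fun x => by ring)
  rw [e1, integral_const_mul] at h
  have e2 : (n : ℝ)⁻¹ * (∫ x, (∑ i, G (x i)) * ∑ i, G (x i) ∂posGibbsMeasure b ε n) -
      (n : ℝ)⁻¹ * (∫ x, ∑ i, G (x i) ∂posGibbsMeasure b ε n) * ∫ x, ∑ i, G (x i) ∂posGibbsMeasure b ε n =
      (n : ℝ)⁻¹ * ((∫ x, (∑ i, G (x i)) * ∑ i, G (x i) ∂posGibbsMeasure b ε n) -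
        (∫ x, ∑ i, G (x i) ∂posGibbsMeasure b ε n) * ∫ x, ∑ i, G (x i) ∂posGibbsMeasure b ε n) := by ring
  rwa [e2] at h

/-- **Taylor bound for the tilted means.** For `|s| ≤ 1/32`:
`|E_s[n⁻¹S_G] - E_0[n⁻¹S_G] - s · (E_0[n⁻¹S_G S_G] - E_0[n⁻¹S_G]E_0[S_G])| ≤ 24576 s²`, uniformly in
`n` under the smallness condition (order-two Taylor remainder of `Φ'` by Cauchy's estimates).
[folklore] -/
theorem tilted_mean_taylor_bound (hb : Continuous b) (hb0 : ∀ x, 0 < b x) (hGc : Continuous G)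
    (hG1 : ∀ x, |G x| ≤ 1) {ε : ℝ} (hε : 0 ≤ ε) (hε2 : ε < 1 / 2) {n : ℕ} (hn : 0 < n)
    (hsmall : 2 * (2 * Real.exp (1 / 4)) ^ 2 * Real.exp 1 ^ 4 * (n * pOv (profileOf b hb hb0) ε) ≤ 1)
    {s : ℝ} (hs : |s| ≤ 1 / 32) :
    |(∫ x, (n : ℝ)⁻¹ * ∑ i, G (x i) ∂posGibbsMeasure (fun x => b x * Real.exp (s * G x)) ε n) -
        (∫ x, (n : ℝ)⁻¹ * ∑ i, G (x i) ∂posGibbsMeasure b ε n) -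
        s * ((∫ x, ((n : ℝ)⁻¹ * ∑ i, G (x i)) * ∑ i, G (x i) ∂posGibbsMeasure b ε n) -
          (∫ x, (n : ℝ)⁻¹ * ∑ i, G (x i) ∂posGibbsMeasure b ε n) * ∫ x, ∑ i, G (x i) ∂posGibbsMeasure b ε n)|
      ≤ 24576 * s ^ 2 := by
  obtain ⟨Φ, hΦ, hΦ3, hreal⟩ := exists_analytic_logPartition_deriv hb hb0 hGc hG1 hε hε2 hn hsmall
  obtain ⟨-, h1s, -⟩ := hreal s (lt_of_le_of_lt hs (by norm_num))
  obtain ⟨-, h10, h20⟩ := hreal 0 (by norm_num)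
  rw [tilt_zero] at h10 h20
  have htaylor := norm_deriv_taylor_le hΦ hΦ3 hs
  have hre : ((deriv Φ s - deriv Φ 0 - (s : ℂ) * deriv (deriv Φ) 0).re) =
      (deriv Φ s).re - (deriv Φ ((0 : ℝ) : ℂ)).re - s * (deriv (deriv Φ) ((0 : ℝ) : ℂ)).re := by
    simp [Complex.sub_re, Complex.mul_re]
  rw [← h20, ← h10, ← h1s, ← hre]
  exact (Complex.abs_re_le_norm _).trans htaylor

/-! ### The covariance bound by polarisation -/

/-- Bounded measurable functions are integrable for the configurational Gibbs measure with
positive partition function. [folklore] -/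
theorem integrable_posGibbsMeasure_of_bounded {a : T3 → ℝ} (ha : Continuous a) (ha0 : ∀ x, 0 ≤ a x)
    {ε : ℝ} {n : ℕ} (hZ : 0 < posPartition a ε n) {F : (Fin n → T3) → ℝ} (hFm : Measurable F) {K : ℝ}
    (hFK : ∀ x, |F x| ≤ K) : Integrable F (posGibbsMeasure a ε n) := by
  haveI := isProbabilityMeasure_posGibbsMeasure_of_pos ha ha0 hZ
  exact Integrable.mono' (integrable_const K) hFm.aestronglyMeasurable
    (ae_of_all _ fun x => (Real.norm_eq_abs _).le.trans (hFK x))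

/-- `|S_G| ≤ n` for `|G| ≤ 1`. [folklore] -/
theorem abs_sum_apply_le (hG1 : ∀ x, |G x| ≤ 1) {n : ℕ} (x : Fin n → T3) : |∑ i, G (x i)| ≤ n :=
  calc |∑ i, G (x i)| ≤ ∑ i, |G (x i)| := Finset.abs_sum_le_sum_abs _ _
    _ ≤ ∑ _i : Fin n, (1 : ℝ) := Finset.sum_le_sum fun i _ => hG1 _
    _ = n := by simp

/-- **Uniform covariance bound.** `|n⁻¹ Cov_b(S_H, S_G)| ≤ 3072` for continuous `|H|, |G| ≤ 1`, under
the smallness condition, uniformly in `n`: polarisation `Cov(S_H, S_G) = Var(S_U) - Var(S_W)` with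
`U = (H+G)/2`, `W = (H-G)/2` and `variance_bound`. [folklore] -/
theorem covariance_bound (hb : Continuous b) (hb0 : ∀ x, 0 < b x) (hHc : Continuous H)
    (hH1 : ∀ x, |H x| ≤ 1) (hGc : Continuous G) (hG1 : ∀ x, |G x| ≤ 1) {ε : ℝ} (hε : 0 ≤ ε)
    (hε2 : ε < 1 / 2) {n : ℕ} (hn : 0 < n)
    (hsmall : 2 * (2 * Real.exp (1 / 4)) ^ 2 * Real.exp 1 ^ 4 * (n * pOv (profileOf b hb hb0) ε) ≤ 1) :
    |(n : ℝ)⁻¹ * ((∫ x, (∑ i, H (x i)) * ∑ i, G (x i) ∂posGibbsMeasure b ε n) -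
        (∫ x, ∑ i, H (x i) ∂posGibbsMeasure b ε n) * ∫ x, ∑ i, G (x i) ∂posGibbsMeasure b ε n)| ≤ 3072 := by
  -- the polarised observables
  set U : T3 → ℝ := fun x => (H x + G x) / 2 with hU
  set W : T3 → ℝ := fun x => (H x - G x) / 2 with hW
  have hUc : Continuous U := by simp only [hU]; fun_prop
  have hWc : Continuous W := by simp only [hW]; fun_prop
  have hU1 : ∀ x, |U x| ≤ 1 := fun x => by
    simp only [hU]; rw [abs_div, abs_two]
    linarith [abs_add_le (H x) (G x), hH1 x, hG1 x]
  have hW1 : ∀ x, |W x| ≤ 1 := fun x => by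
    simp only [hW]; rw [abs_div, abs_two]
    linarith [abs_sub (H x) (G x), hH1 x, hG1 x]
  have hVU := variance_bound hb hb0 hUc hU1 hε hε2 hn hsmall
  have hVW := variance_bound hb hb0 hWc hW1 hε hε2 hn hsmall
  -- positivity of the partition function and integrability
  obtain ⟨Φ, -, -, hreal⟩ := exists_analytic_logPartition_deriv hb hb0 hGc hG1 hε hε2 hn hsmall
  obtain ⟨hZ, -, -⟩ := hreal 0 (by norm_num)
  rw [tilt_zero] at hZ
  set μ := posGibbsMeasure b ε n with hμ
  have hb0' : ∀ x, 0 ≤ b x := fun x => (hb0 x).le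
  have hint : ∀ {F : (Fin n → T3) → ℝ}, Measurable F → ∀ {K : ℝ}, (∀ x, |F x| ≤ K) → Integrable F μ :=
    fun hFm K hFK => integrable_posGibbsMeasure_of_bounded hb hb0' hZ hFm hFK
  have hSH := hint (LocalGibbsConcentration.measurable_sum hHc n) (abs_sum_apply_le hH1)
  have hSG := hint (LocalGibbsConcentration.measurable_sum hGc n) (abs_sum_apply_le hG1)
  have hSU := hint (LocalGibbsConcentration.measurable_sum hUc n) (abs_sum_apply_le hU1)
  have hSW := hint (LocalGibbsConcentration.measurable_sum hWc n) (abs_sum_apply_le hW1)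
  -- pointwise polarisation
  have hHeq : ∀ x : Fin n → T3, ∑ i, H (x i) = (∑ i, U (x i)) + ∑ i, W (x i) := fun x => by
    rw [← Finset.sum_add_distrib]
    exact Finset.sum_congr rfl fun i _ => by simp only [hU, hW]; ring
  have hGeq : ∀ x : Fin n → T3, ∑ i, G (x i) = (∑ i, U (x i)) - ∑ i, W (x i) := fun x => by
    rw [← Finset.sum_sub_distrib]
    exact Finset.sum_congr rfl fun i _ => by simp only [hU, hW]; ring
  have hprod : ∀ x : Fin n → T3, (∑ i, H (x i)) * ∑ i, G (x i) =
      (∑ i, U (x i)) * (∑ i, U (x i)) - (∑ i, W (x i)) * ∑ i, W (x i) := fun x => by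
    rw [hHeq, hGeq]; ring
  have hUU := hint (F := fun x => (∑ i, U (x i)) * ∑ i, U (x i))
    ((LocalGibbsConcentration.measurable_sum hUc n).mul (LocalGibbsConcentration.measurable_sum hUc n)) (K := (n : ℝ) * n)
    (fun x => by rw [abs_mul]; exact mul_le_mul (abs_sum_apply_le hU1 x) (abs_sum_apply_le hU1 x) (abs_nonneg _) (Nat.cast_nonneg _))
  have hWW := hint (F := fun x => (∑ i, W (x i)) * ∑ i, W (x i))
    ((LocalGibbsConcentration.measurable_sum hWc n).mul (LocalGibbsConcentration.measurable_sum hWc n)) (K := (n : ℝ) * n)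
    (fun x => by rw [abs_mul]; exact mul_le_mul (abs_sum_apply_le hW1 x) (abs_sum_apply_le hW1 x) (abs_nonneg _) (Nat.cast_nonneg _))
  have e1 : (∫ x, (∑ i, H (x i)) * ∑ i, G (x i) ∂μ) =
      (∫ x, (∑ i, U (x i)) * ∑ i, U (x i) ∂μ) - ∫ x, (∑ i, W (x i)) * ∑ i, W (x i) ∂μ := by
    rw [← integral_sub hUU hWW]
    exact integral_congr_ae (ae_of_all _ fun x => hprod x)
  have e2 : (∫ x, ∑ i, H (x i) ∂μ) = (∫ x, ∑ i, U (x i) ∂μ) + ∫ x, ∑ i, W (x i) ∂μ := by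
    rw [← integral_add hSU hSW]
    exact integral_congr_ae (ae_of_all _ fun x => hHeq x)
  have e3 : (∫ x, ∑ i, G (x i) ∂μ) = (∫ x, ∑ i, U (x i) ∂μ) - ∫ x, ∑ i, W (x i) ∂μ := by
    rw [← integral_sub hSU hSW]
    exact integral_congr_ae (ae_of_all _ fun x => hGeq x)
  have key : (n : ℝ)⁻¹ * ((∫ x, (∑ i, H (x i)) * ∑ i, G (x i) ∂μ) - (∫ x, ∑ i, H (x i) ∂μ) * ∫ x, ∑ i, G (x i) ∂μ) =
      (n : ℝ)⁻¹ * ((∫ x, (∑ i, U (x i)) * ∑ i, U (x i) ∂μ) - (∫ x, ∑ i, U (x i) ∂μ) * ∫ x, ∑ i, U (x i) ∂μ) -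
      (n : ℝ)⁻¹ * ((∫ x, (∑ i, W (x i)) * ∑ i, W (x i) ∂μ) - (∫ x, ∑ i, W (x i) ∂μ) * ∫ x, ∑ i, W (x i) ∂μ) := by
    rw [e1, e2, e3]; ring
  rw [key]
  calc _ ≤ |(n : ℝ)⁻¹ * ((∫ x, (∑ i, U (x i)) * ∑ i, U (x i) ∂μ) - (∫ x, ∑ i, U (x i) ∂μ) * ∫ x, ∑ i, U (x i) ∂μ)| +
        |(n : ℝ)⁻¹ * ((∫ x, (∑ i, W (x i)) * ∑ i, W (x i) ∂μ) - (∫ x, ∑ i, W (x i) ∂μ) * ∫ x, ∑ i, W (x i) ∂μ)| :=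
        abs_sub _ _
    _ ≤ 1536 + 1536 := add_le_add hVU hVW
    _ = 3072 := by norm_num

end Summit.AtomisticToContinuum.HydrodynamicLimit.Theorems

end

/-!
# `StaticScoreResponse` (support item stmt-AtomisticToContinuum-12269): equicontinuity of the
# canonical means in the activity and in the observable

Two Lipschitz-type estimates for the canonical means `E_b[n⁻¹ S_χ]`, `S_χ = ∑ᵢ χ(xᵢ)`, of the
configurational canonical Gibbs measure `posGibbsMeasure b ε n`, uniform in the number of
particles `n` (low density):

* `abs_integral_avg_sum_le` — `|E_b[n⁻¹ S_χ]| ≤ η` if `|χ| ≤ η` (trivial);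
* `mean_base_change_le` — **base change**: `|E_{b e^H}[n⁻¹ S_χ] - E_b[n⁻¹ S_χ]| ≤ 3072 η` for
  continuous `|H| ≤ η ≤ 1/8`, `|χ| ≤ 1`, by the mean value theorem along the tilt family
  `u ↦ b e^{u H/η}` whose derivative is the covariance `n⁻¹ Cov(S_{H/η}, S_χ)`
  (`hasDerivAt_tilted_mean`), bounded by `covariance_bound`.

These give the equicontinuity in the homotopy parameter `κ` needed to upgrade pointwise laws of
large numbers to uniform ones in the proof of `StaticScoreResponse`. Folklore; no definitions, no
named facts.
-/

noncomputable section

namespace Summit.AtomisticToContinuum.HydrodynamicLimit.Theorems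

open Finset MeasureTheory Metric Set Filter Topology
  Literature.MathematicalPhysics.StatisticalMechanics Literature.MathematicalPhysics.KineticTheory

variable {b χ H : T3 → ℝ}

/-- **Means of small observables are small**: `|E_a[n⁻¹ S_χ]| ≤ η` for `|χ| ≤ η` and a probability
measure. [folklore] -/
theorem abs_integral_avg_sum_le {n : ℕ} {μ : Measure (Fin n → T3)} [IsProbabilityMeasure μ] {η : ℝ}
    (hη : 0 ≤ η) (hχη : ∀ x, |χ x| ≤ η) :
    |∫ x, (n : ℝ)⁻¹ * ∑ i, χ (x i) ∂μ| ≤ η := by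
  have hpt : ∀ x : Fin n → T3, |(n : ℝ)⁻¹ * ∑ i, χ (x i)| ≤ η := by
    intro x
    rcases Nat.eq_zero_or_pos n with hn | hn
    · subst hn; simpa using hη
    have hn' : (0 : ℝ) < n := by exact_mod_cast hn
    rw [abs_mul, abs_of_pos (inv_pos.2 hn')]
    calc (n : ℝ)⁻¹ * |∑ i, χ (x i)| ≤ (n : ℝ)⁻¹ * (n * η) := by
          refine mul_le_mul_of_nonneg_left ?_ (by positivity)
          calc |∑ i, χ (x i)| ≤ ∑ i, |χ (x i)| := Finset.abs_sum_le_sum_abs _ _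
            _ ≤ ∑ _i : Fin n, η := Finset.sum_le_sum fun i _ => hχη _
            _ = n * η := by simp
      _ = η := by field_simp
  calc |∫ x, (n : ℝ)⁻¹ * ∑ i, χ (x i) ∂μ| ≤ ∫ x, |(n : ℝ)⁻¹ * ∑ i, χ (x i)| ∂μ := by
        have := norm_integral_le_integral_norm (μ := μ) (fun x => (n : ℝ)⁻¹ * ∑ i, χ (x i))
        simpa only [Real.norm_eq_abs] using this
    _ ≤ ∫ _x, η ∂μ := by
        refine integral_mono_of_nonneg (ae_of_all _ fun x => abs_nonneg _) (integrable_const η)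
          (ae_of_all _ fun x => hpt x)
    _ = η := by simp

/-- The exponential tilt by `H` written through the normalised direction `H/η`. [folklore] -/
theorem tilt_normalise {η : ℝ} (hη : η ≠ 0) (b H : T3 → ℝ) :
    (fun x => b x * Real.exp (η * (H x / η))) = fun x => b x * Real.exp (H x) := by
  funext x; rw [mul_div_cancel₀ _ hη]

/-- **Base change estimate.** For continuous positive `b`, continuous `|H| ≤ η` with
`0 < η ≤ 1/8`, continuous `|χ| ≤ 1`, `0 ≤ ε < 1/2`, `n ≥ 1`, and the cumulant smallness for all the
tilted activities `b e^{uH/η}`, `|u| < 1/4`: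
`|E_{b e^H}[n⁻¹ S_χ] - E_b[n⁻¹ S_χ]| ≤ 3072 η` (mean value theorem along `u ↦ b e^{uH/η}`,
derivative `= n⁻¹ Cov(S_{H/η}, S_χ)`, `covariance_bound`). [folklore] -/
theorem mean_base_change_le (hb : Continuous b) (hb0 : ∀ x, 0 < b x) (hHc : Continuous H) {η : ℝ}
    (hη0 : 0 < η) (hη : η ≤ 1 / 8) (hHη : ∀ x, |H x| ≤ η) (hχc : Continuous χ) (hχ1 : ∀ x, |χ x| ≤ 1)
    {ε : ℝ} (hε : 0 ≤ ε) (hε2 : ε < 1 / 2) {n : ℕ} (hn : 0 < n)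
    (hsmall : ∀ u : ℝ, |u| < 1 / 4 → 2 * (2 * Real.exp (1 / 4)) ^ 2 * Real.exp 1 ^ 4 *
      (n * pOv (profileOf (fun x => b x * Real.exp (u * (H x / η)))
        (LocalGibbsConcentration.continuous_tilt hb (hHc.div_const η) u)
        (LocalGibbsConcentration.tilt_pos hb0 (fun x => H x / η) u)) ε) ≤ 1) :
    |(∫ x, (n : ℝ)⁻¹ * ∑ i, χ (x i) ∂posGibbsMeasure (fun x => b x * Real.exp (H x)) ε n) -
        (∫ x, (n : ℝ)⁻¹ * ∑ i, χ (x i) ∂posGibbsMeasure b ε n)| ≤ 3072 * η := by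
  -- the normalised direction
  set G : T3 → ℝ := fun x => H x / η with hGdef
  have hGc : Continuous G := hHc.div_const η
  have hG1 : ∀ x, |G x| ≤ 1 := fun x => by
    rw [hGdef]; dsimp only
    rw [abs_div, abs_of_pos hη0, div_le_one hη0]; exact hHη x
  -- the mean along the tilt family and its derivative
  set g : ℝ → ℝ := fun u => ∫ x, (n : ℝ)⁻¹ * ∑ i, χ (x i) ∂posGibbsMeasure (fun x => b x * Real.exp (u * G x)) ε n
    with hgdef
  have hderiv : ∀ u : ℝ, |u| < 1 / 4 → HasDerivAt g
      ((∫ x, ((n : ℝ)⁻¹ * ∑ i, χ (x i)) * ∑ i, G (x i) ∂posGibbsMeasure (fun x => b x * Real.exp (u * G x)) ε n) -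
        (∫ x, (n : ℝ)⁻¹ * ∑ i, χ (x i) ∂posGibbsMeasure (fun x => b x * Real.exp (u * G x)) ε n) *
          ∫ x, ∑ i, G (x i) ∂posGibbsMeasure (fun x => b x * Real.exp (u * G x)) ε n) u := by
    intro u hu
    obtain ⟨Φ, -, -, hreal⟩ := exists_analytic_logPartition (hb) hb0 hGc hG1 hε hε2 hn (by
      have := hsmall 0 (by norm_num)
      simpa [tilt_zero] using this)
    obtain ⟨hZ, -⟩ := hreal u hu
    exact hasDerivAt_tilted_mean hb hb0 hGc hG1 hu hZ (measurable_avg_sum hχc n) (abs_avg_sum_le hχ1)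
  -- the derivative is a covariance, bounded by `3072`
  have hbound : ∀ u : ℝ, |u| < 1 / 4 →
      |(∫ x, ((n : ℝ)⁻¹ * ∑ i, χ (x i)) * ∑ i, G (x i) ∂posGibbsMeasure (fun x => b x * Real.exp (u * G x)) ε n) -
        (∫ x, (n : ℝ)⁻¹ * ∑ i, χ (x i) ∂posGibbsMeasure (fun x => b x * Real.exp (u * G x)) ε n) *
          ∫ x, ∑ i, G (x i) ∂posGibbsMeasure (fun x => b x * Real.exp (u * G x)) ε n| ≤ 3072 := by
    intro u hu
    have hcov := covariance_bound (b := fun x => b x * Real.exp (u * G x)) (LocalGibbsConcentration.continuous_tilt hb hGc u)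
      (LocalGibbsConcentration.tilt_pos hb0 G u) hχc hχ1 hGc hG1 hε hε2 hn (hsmall u hu)
    set μ := posGibbsMeasure (fun x => b x * Real.exp (u * G x)) ε n with hμ
    have e1 : (∫ x, ((n : ℝ)⁻¹ * ∑ i, χ (x i)) * ∑ i, G (x i) ∂μ) = (n : ℝ)⁻¹ * ∫ x, (∑ i, χ (x i)) * ∑ i, G (x i) ∂μ := by
      rw [← integral_const_mul]; exact integral_congr_ae (ae_of_all _ fun x => by ring)
    have e2 : (∫ x, (n : ℝ)⁻¹ * ∑ i, χ (x i) ∂μ) = (n : ℝ)⁻¹ * ∫ x, ∑ i, χ (x i) ∂μ := integral_const_mul _ _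
    rw [e1, e2]
    have e3 : (n : ℝ)⁻¹ * (∫ x, (∑ i, χ (x i)) * ∑ i, G (x i) ∂μ) - (n : ℝ)⁻¹ * (∫ x, ∑ i, χ (x i) ∂μ) * ∫ x, ∑ i, G (x i) ∂μ =
        (n : ℝ)⁻¹ * ((∫ x, (∑ i, χ (x i)) * ∑ i, G (x i) ∂μ) - (∫ x, ∑ i, χ (x i) ∂μ) * ∫ x, ∑ i, G (x i) ∂μ) := by ring
    rw [e3]
    exact hcov
  -- mean value theorem on `[0, η]`
  have hMVT := Convex.norm_image_sub_le_of_norm_hasDerivWithin_le (f := g) (s := Icc 0 η) (C := 3072)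
    (fun u hu => (hderiv u (by rw [abs_of_nonneg hu.1]; linarith [hu.2])).hasDerivWithinAt)
    (fun u hu => by
      rw [Real.norm_eq_abs]
      exact hbound u (by rw [abs_of_nonneg hu.1]; linarith [hu.2]))
    (convex_Icc 0 η) (left_mem_Icc.2 hη0.le) (right_mem_Icc.2 hη0.le)
  rw [Real.norm_eq_abs, Real.norm_eq_abs, sub_zero, abs_of_pos hη0] at hMVT
  -- identify the endpoints
  have hgη : g η = ∫ x, (n : ℝ)⁻¹ * ∑ i, χ (x i) ∂posGibbsMeasure (fun x => b x * Real.exp (H x)) ε n := by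
    rw [hgdef]; dsimp only; rw [hGdef, tilt_normalise hη0.ne']
  have hg0 : g 0 = ∫ x, (n : ℝ)⁻¹ * ∑ i, χ (x i) ∂posGibbsMeasure b ε n := by
    rw [hgdef]; dsimp only; rw [tilt_zero]
  rw [← hgη, ← hg0]
  linarith

end Summit.AtomisticToContinuum.HydrodynamicLimit.Theorems

end
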